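import Summits.ResolutionOfSingularities.ResolutionOfSingularities.Theorems.WeightedInvariantLocalWeightedDropNCGameRank

/-!
# `WeightedInvariant.LocalWeightedDrop`: DECORATED winning regions for the NC count game — composition (`bind`), measures, and
# extraction of the positional rank (the assembly backbone of the TOT2-LINE under `stub_spaceNCRankDrop`, skeleton v32)

Crux item stmt-ResolutionOfSingularities-8899 `LocalWeightedDrop` (route `ResolutionOfSingularities/WeightedInvariant`), ENGINE skeleton v32
(ddb48572591139d5), registered stub `stub_spaceNCRankDrop`.  [OURS · L1 W4.3 · chain w43 · lead-1 gen 4 (engine registrar), TOT2-LINE v1 §1/§7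
(`L/res-L1-w43-lead-1/g4/TOT2-LINE.md`).  Game bookkeeping only; the count game is the programme's own (res-type-056); nothing here is a statement of
any manuscript.  AI-produced, gate-checked, weaker than expert review.]

WHY.  The strategies in print for embedded resolution of surfaces (Cossart–Jannsen–Saito LNM 2270 §5; Perlega arXiv:2011.14443 Ch. 7) act on
DECORATED states (the germ together with its boundary and the boundary's history) and are proved to terminate REGIME BY REGIME («no infinite chain
of fundamental units», «the curve part is resolved after finitely many point blow-ups», …).  To assemble such regime theorems WITHOUT a global
invariant and WITHOUT an infinite-play pigeonhole, this file provides a decorated, target-relative notion of winning region and its calculus: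

* `DWinsTo germ Q σ` — from the decorated state `σ : St` (any type `St` with a projection `germ : St → k⟦x₀..x_m⟧`) the mover can force, by count-game
  moves read on `germ`, a decorated state satisfying the TARGET `Q : St → Prop` (certificate: a set of states ranked by ordinals, every non-target
  member having a move all of whose successor GERMS are germs of members of smaller rank — the decoration of the successor is the mover's choice);
* `DWinsTo.of_target`, `DWinsTo.mono` — targets reached, monotone in the target;
* `DWinsTo.of_measure` — a regime theorem in MEASURE form (an ordinal measure lowered at every successor until the target) gives `DWinsTo`;
* `DWinsTo.bind` — COMPOSITION: reach `Q`, and from every `Q`-state reach `P` ⇒ reach `P` (ordinal bookkeeping: rank `:= min (second-stage value, Ω + first-stage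
  rank)`, `Ω` strictly above the second-stage values at the states where the first stage ends);
* `DWinsTo.wf_induction` — well-founded assembly: if from every state one reaches «terminal, or a state of smaller measure `μ`», then from every state
  one reaches terminal (the outer induction on `(o, c) = (ord f, ord f + #old components)` of the line);
* `winsOrd_of_dWinsTo`, `ncRankDrop_of_dWinsTo` — EXTRACTION: decorated winning to the target «the germ is terminal for `P`» from decorations of
  every non-zero germ gives `WinsOrd P` everywhere, hence (with `rank_of_winsOrd`, p525270) the hypothesis text of `stub_spaceNCRankDrop` /
  `tameWideApexFourStartsWon_of_ncRankDrop` (p526032).  (res-L1-w43-stub-1's `rankDrop_of_decoratedRank` is the same extraction in «one-step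
  measure» form; the two are interchangeable at the end, `bind`/`wf_induction` are what the regime hands compose with.)
-/

set_option linter.dupNamespace false -- mandated namespace of this single-conjunct summit

noncomputable section

namespace Summit.ResolutionOfSingularities.ResolutionOfSingularities.Theorems

namespace TameFourTupleDrop

open MvPowerSeries Literature.AlgebraicGeometry.Resolution

variable {k : Type} [Field k] {m : ℕ} {St : Type}

/-! ## Decorated winning regions relative to a target -/

/-- A DECORATED RANKED REGION towards the target `Q`: a set `T` of decorated states with an ordinal rank `ρ` such that from every member not in
the target some count-game move (on its germ) has, at every answer, a successor germ carried by a member of `T` of smaller rank. -/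
def DRankedRegion (germ : St → MvPowerSeries (Fin (m + 1)) k) (Q : St → Prop) (T : Set St) (ρ : St → Ordinal.{0}) : Prop :=
  ∀ τ ∈ T, ¬ Q τ → ∃ (Φ : Fin (m + 1) → MvPowerSeries (Fin (m + 1)) k) (w : Fin (m + 1) → ℕ),
    IsCountMove Φ w ∧ MoveClause (germ τ) Φ w (fun b' => ∃ τ' ∈ T, germ τ' = b' ∧ ρ τ' < ρ τ)

/-- `DWinsTo germ Q σ`: the mover forces the target `Q` from the decorated state `σ` — some decorated ranked region towards `Q` contains `σ`. -/
def DWinsTo (germ : St → MvPowerSeries (Fin (m + 1)) k) (Q : St → Prop) (σ : St) : Prop :=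
  ∃ (T : Set St) (ρ : St → Ordinal.{0}), DRankedRegion germ Q T ρ ∧ σ ∈ T

/-- The VALUE form: `σ` lies in a region towards `Q` with rank at most `α`. -/
def DWinsToBy (germ : St → MvPowerSeries (Fin (m + 1)) k) (Q : St → Prop) (α : Ordinal.{0}) (σ : St) : Prop :=
  ∃ (T : Set St) (ρ : St → Ordinal.{0}), DRankedRegion germ Q T ρ ∧ σ ∈ T ∧ ρ σ ≤ α

variable {germ : St → MvPowerSeries (Fin (m + 1)) k}

/-- A state has a value iff it is winning. -/
theorem dWinsTo_iff_exists_by {Q : St → Prop} {σ : St} : DWinsTo germ Q σ ↔ ∃ α, DWinsToBy germ Q α σ :=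
  ⟨fun ⟨T, ρ, hT, hσ⟩ => ⟨ρ σ, T, ρ, hT, hσ, le_rfl⟩, fun ⟨_, T, ρ, hT, hσ, _⟩ => ⟨T, ρ, hT, hσ⟩⟩

/-- A target state is winning (one-point region). -/
theorem DWinsTo.of_target {Q : St → Prop} {σ : St} (h : Q σ) : DWinsTo germ Q σ :=
  ⟨{σ}, fun _ => 0, fun τ hτ hQ => absurd (by rw [Set.mem_singleton_iff.mp hτ]; exact h) hQ, Set.mem_singleton σ⟩

/-- A target state has value `0`. -/
theorem DWinsToBy.of_target {Q : St → Prop} {σ : St} (h : Q σ) (α : Ordinal.{0}) : DWinsToBy germ Q α σ :=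
  ⟨{σ}, fun _ => 0, fun τ hτ hQ => absurd (by rw [Set.mem_singleton_iff.mp hτ]; exact h) hQ, Set.mem_singleton σ, bot_le⟩

/-- Monotonicity in the target. -/
theorem DRankedRegion.mono {Q Q' : St → Prop} (hQ : ∀ τ, Q τ → Q' τ) {T : Set St} {ρ : St → Ordinal.{0}}
    (h : DRankedRegion germ Q T ρ) : DRankedRegion germ Q' T ρ :=
  fun τ hτ hQ' => h τ hτ fun hq => hQ' (hQ τ hq)

/-- Monotonicity in the target. -/
theorem DWinsTo.mono {Q Q' : St → Prop} (hQ : ∀ τ, Q τ → Q' τ) {σ : St} (h : DWinsTo germ Q σ) : DWinsTo germ Q' σ := by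
  obtain ⟨T, ρ, hT, hσ⟩ := h
  exact ⟨T, ρ, hT.mono hQ, hσ⟩

/-- From a winning non-target state some move leads, at every answer, to winning states of smaller value. -/
theorem DWinsToBy.exists_move {Q : St → Prop} {α : Ordinal.{0}} {σ : St} (h : DWinsToBy germ Q α σ) (hQ : ¬ Q σ) :
    ∃ (Φ : Fin (m + 1) → MvPowerSeries (Fin (m + 1)) k) (w : Fin (m + 1) → ℕ),
      IsCountMove Φ w ∧ MoveClause (germ σ) Φ w (fun b' => ∃ τ', germ τ' = b' ∧ ∃ β < α, DWinsToBy germ Q β τ') := by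
  obtain ⟨T, ρ, hT, hσ, hρ⟩ := h
  obtain ⟨Φ, w, hmv, hcl⟩ := hT σ hσ hQ
  exact ⟨Φ, w, hmv, hcl.mono fun b' ⟨τ', hτ', hb', hlt⟩ => ⟨τ', hb', ρ τ', lt_of_lt_of_le hlt hρ, T, ρ, hT, hτ', le_rfl⟩⟩

/-! ## Regime theorems in measure form -/

/-- **MEASURE FORM.**  If on a class `C` of states (stable is not required: leaving `C` must happen through the target) an ordinal measure `μ` is
lowered at every answer of some move from every non-target member — successors being decorated inside `C ∪ Q` — then every member of `C` wins
towards `Q`. -/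
theorem DWinsTo.of_measure {Q : St → Prop} (C : Set St) (μ : St → Ordinal.{0})
    (hstep : ∀ τ ∈ C, ¬ Q τ → ∃ (Φ : Fin (m + 1) → MvPowerSeries (Fin (m + 1)) k) (w : Fin (m + 1) → ℕ),
      IsCountMove Φ w ∧ MoveClause (germ τ) Φ w (fun b' => ∃ τ', germ τ' = b' ∧ (Q τ' ∨ (τ' ∈ C ∧ μ τ' < μ τ))))
    {σ : St} (hσ : σ ∈ C) : DWinsTo germ Q σ := by
  classical
  -- region: `C` together with all target states; rank: `μ + 1` on non-target states, `0` on target states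
  refine ⟨C ∪ {τ | Q τ}, fun τ => if Q τ then 0 else μ τ + 1, ?_, Or.inl hσ⟩
  intro τ hτ hQ
  have hτC : τ ∈ C := hτ.resolve_right hQ
  obtain ⟨Φ, w, hmv, hcl⟩ := hstep τ hτC hQ
  refine ⟨Φ, w, hmv, hcl.mono fun b' ⟨τ', hb', hτ'⟩ => ?_⟩
  rcases hτ' with hq | ⟨hC', hlt⟩
  · refine ⟨τ', Or.inr hq, hb', ?_⟩
    show (if Q τ' then (0 : Ordinal.{0}) else μ τ' + 1) < (if Q τ then 0 else μ τ + 1)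
    rw [if_pos hq, if_neg hQ]
    exact Order.lt_add_one_iff.mpr bot_le
  · refine ⟨τ', Or.inl hC', hb', ?_⟩
    show (if Q τ' then (0 : Ordinal.{0}) else μ τ' + 1) < (if Q τ then 0 else μ τ + 1)
    rw [if_neg hQ]
    split_ifs
    · exact Order.lt_add_one_iff.mpr bot_le
    · exact Order.lt_add_one_iff.mpr (Order.add_one_le_of_lt hlt)

/-! ## Composition -/

/-- **BIND.**  If `σ` wins towards `Q`, and every `Q`-state wins towards `P`, then `σ` wins towards `P`.  (Region: the non-target part of the
first region together with all `P`-winning states; rank: the minimum of `Ω + ρ₁` (first stage; `Ω` strictly above the `P`-values of the `Q`-states met)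
and of the `P`-value (second stage) — whichever attains the minimum supplies the move.) -/
theorem DWinsTo.bind {Q P : St → Prop} {σ : St} (h : DWinsTo germ Q σ) (hQP : ∀ τ, Q τ → DWinsTo germ P τ) : DWinsTo germ P σ := by
  classical
  obtain ⟨T₁, ρ₁, hT₁, hσ⟩ := h
  -- second stage: the value of a state for the target `P` (least rank over regions towards `P`), on the winning states
  let W : Set St := {τ | DWinsTo germ P τ}
  let val : St → Ordinal.{0} := fun τ => sInf {α | DWinsToBy germ P α τ}
  have hval : ∀ τ ∈ W, DWinsToBy germ P (val τ) τ := fun τ hτ => csInf_mem (dWinsTo_iff_exists_by.mp hτ)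
  have hval_le : ∀ {τ α}, DWinsToBy germ P α τ → val τ ≤ α := fun h => csInf_le' h
  -- the bound `Ω` on second-stage values entered from `T₁`'s target states
  let vQ : {τ : St // τ ∈ T₁ ∧ Q τ} → Ordinal.{0} := fun τ => val τ.1 + 1
  let Ω : Ordinal.{0} := ⨆ τ, vQ τ
  have hΩ : ∀ τ, τ ∈ T₁ → Q τ → val τ < Ω := fun τ h₁ h₂ =>
    lt_of_lt_of_le (Order.lt_add_one_iff.mpr le_rfl)
      (le_ciSup (Ordinal.bddAbove_of_small (s := Set.range vQ)) (⟨τ, h₁, h₂⟩ : {τ : St // τ ∈ T₁ ∧ Q τ}))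
  -- region and rank
  let T₁' : Set St := T₁ ∩ {τ | ¬ Q τ}
  let T : Set St := W ∪ T₁'
  let ρ : St → Ordinal.{0} := fun τ =>
    if τ ∈ W then (if τ ∈ T₁' then min (val τ) (Ω + ρ₁ τ) else val τ) else Ω + ρ₁ τ
  have hρW : ∀ τ ∈ W, ρ τ ≤ val τ := by
    intro τ hτ
    simp only [ρ, if_pos hτ]
    split_ifs
    · exact min_le_left _ _
    · exact le_rfl
  have hρ1 : ∀ τ ∈ T₁', ρ τ ≤ Ω + ρ₁ τ := by
    intro τ hτ
    simp only [ρ, if_pos hτ]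
    split_ifs
    · exact min_le_right _ _
    · exact le_rfl
  have hcases : ∀ τ ∈ T, (τ ∈ W ∧ ρ τ = val τ) ∨ (τ ∈ T₁' ∧ ρ τ = Ω + ρ₁ τ) := by
    intro τ hτ
    by_cases hW : τ ∈ W
    · by_cases h1 : τ ∈ T₁'
      · simp only [ρ, if_pos hW, if_pos h1]
        rcases le_total (val τ) (Ω + ρ₁ τ) with h | h
        · exact Or.inl ⟨hW, min_eq_left h⟩
        · exact Or.inr ⟨h1, min_eq_right h⟩
      · exact Or.inl ⟨hW, by simp only [ρ, if_pos hW, if_neg h1]⟩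
    · exact Or.inr ⟨hτ.resolve_left hW, by simp only [ρ, if_neg hW]⟩
  refine ⟨T, ρ, ?_, ?_⟩
  · intro τ hτ hP
    rcases hcases τ hτ with ⟨hW, hρτ⟩ | ⟨h1, hρτ⟩
    · -- second stage: play the value-attaining region's move
      obtain ⟨Φ, w, hmv, hcl⟩ := (hval τ hW).exists_move hP
      refine ⟨Φ, w, hmv, hcl.mono fun b' ⟨τ', hb', β, hβ, hτ'⟩ => ?_⟩
      have hW' : τ' ∈ W := dWinsTo_iff_exists_by.mpr ⟨β, hτ'⟩
      refine ⟨τ', Or.inl hW', hb', ?_⟩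
      rw [hρτ]
      exact lt_of_le_of_lt ((hρW τ' hW').trans (hval_le hτ')) hβ
    · -- first stage: play `T₁`'s move
      obtain ⟨Φ, w, hmv, hcl⟩ := hT₁ τ h1.1 h1.2
      refine ⟨Φ, w, hmv, hcl.mono fun b' ⟨τ', hτ'₁, hb', hlt⟩ => ?_⟩
      rw [hρτ]
      by_cases hQ' : Q τ'
      · have hW' : τ' ∈ W := hQP τ' hQ'
        exact ⟨τ', Or.inl hW', hb', lt_of_le_of_lt (hρW τ' hW') (lt_of_lt_of_le (hΩ τ' hτ'₁ hQ') le_self_add)⟩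
      · have h1' : τ' ∈ T₁' := ⟨hτ'₁, hQ'⟩
        exact ⟨τ', Or.inr h1', hb', lt_of_le_of_lt (hρ1 τ' h1') ((add_lt_add_iff_left Ω).mpr hlt)⟩
  · by_cases hQ : Q σ
    · exact Or.inl (hQP σ hQ)
    · exact Or.inr ⟨hσ, hQ⟩

/-! ## Well-founded assembly -/

/-- **WELL-FOUNDED ASSEMBLY.**  If from every state the mover forces «terminal, or a state of strictly smaller measure», for an ordinal measure `μ`
on decorated states, then from every state the mover forces terminal. -/
theorem DWinsTo.wf_induction {P : St → Prop} (μ : St → Ordinal.{0})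
    (h : ∀ σ, DWinsTo germ (fun τ => P τ ∨ μ τ < μ σ) σ) : ∀ σ, DWinsTo germ P σ := by
  intro σ
  induction hμ : μ σ using WellFoundedLT.induction generalizing σ with
  | ind α ih =>
    subst hμ
    exact (h σ).bind fun τ hτ => hτ.elim DWinsTo.of_target fun hlt => ih (μ τ) hlt τ rfl

/-! ## Extraction of the positional statement -/

/-- **DECORATED WINNING ⇒ TRANSFINITE WINNABILITY OF THE GERM.**  If a decorated state wins towards «the germ is terminal for `P`», its germ is
transfinitely winnable for `P` in the sense of `WinsOrd` (…NCGameRank): project the region, rank a germ by the least rank of a state carrying it. -/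
theorem winsOrd_of_dWinsTo {P : MvPowerSeries (Fin (m + 1)) k → Prop} {σ : St} (h : DWinsTo germ (fun τ => P (germ τ)) σ) :
    ∃ α, WinsOrd P α (germ σ) := by
  classical
  obtain ⟨T, ρ, hT, hσ⟩ := h
  let T' : Set (MvPowerSeries (Fin (m + 1)) k) := germ '' T
  let ρ' : MvPowerSeries (Fin (m + 1)) k → Ordinal.{0} := fun b => sInf (ρ '' {τ | τ ∈ T ∧ germ τ = b})
  refine ⟨ρ' (germ σ), T', ρ', ?_, ⟨σ, hσ, rfl⟩, le_rfl⟩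
  intro b hb hPb
  -- a carrier of least rank
  have hne : (ρ '' {τ | τ ∈ T ∧ germ τ = b}).Nonempty := by
    obtain ⟨τ, hτ, rfl⟩ := hb
    exact ⟨ρ τ, τ, ⟨hτ, rfl⟩, rfl⟩
  obtain ⟨τ, ⟨hτT, hτb⟩, hτρ⟩ := (Set.mem_image _ _ _).mp (csInf_mem hne)
  obtain ⟨Φ, w, hmv, hcl⟩ := hT τ hτT (by show ¬ P (germ τ); rw [hτb]; exact hPb)
  rw [hτb] at hcl
  refine ⟨Φ, w, hmv, hcl.mono fun b' ⟨τ', hτ'T, hb', hlt⟩ => ⟨⟨τ', hτ'T, hb'⟩, ?_⟩⟩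
  calc ρ' b' ≤ ρ τ' := csInf_le' ⟨τ', ⟨hτ'T, hb'⟩, rfl⟩
    _ < ρ τ := hlt
    _ = ρ' b := hτρ

/-- **THE POSITIONAL STATEMENT FROM DECORATED WINNING.**  If every non-zero germ carries some decorated state which wins towards «germ terminal
for `P`», and `P` is radical-hereditary, then ONE ordinal rank on germs is lowered by some move at every answer from every non-zero non-terminal
germ — the hypothesis text of `tupleDropThree_of_ncRankDrop` / `tameWideApexFourStartsWon_of_ncRankDrop` (p526032) and of the registered stub
`stub_spaceNCRankDrop` (skeleton v32) at `m + 1 = 3`, `P = GermIsNC`. -/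
theorem ncRankDrop_of_dWinsTo {P : MvPowerSeries (Fin (m + 1)) k → Prop}
    (hP : ∀ (N : ℕ) (b d : MvPowerSeries (Fin (m + 1)) k), d ≠ 0 → P d → b ∣ d ^ (N + 1) → P b)
    (hwin : ∀ b : MvPowerSeries (Fin (m + 1)) k, b ≠ 0 → ∃ σ : St, germ σ = b ∧ DWinsTo germ (fun τ => P (germ τ)) σ) :
    ∃ ρ : MvPowerSeries (Fin (m + 1)) k → Ordinal.{0}, ∀ b : MvPowerSeries (Fin (m + 1)) k, b ≠ 0 → ¬ P b →
      ∃ (Φ : Fin (m + 1) → MvPowerSeries (Fin (m + 1)) k) (w : Fin (m + 1) → ℕ),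
        IsCountMove Φ w ∧ MoveClause b Φ w (fun b' => ρ b' < ρ b) := by
  have hwin' : ∀ b : MvPowerSeries (Fin (m + 1)) k, b ≠ 0 → ∃ α, WinsOrd P α b := by
    intro b hb
    obtain ⟨σ, rfl, hσ⟩ := hwin b hb
    exact winsOrd_of_dWinsTo hσ
  obtain ⟨ν, -, -, h3⟩ := rank_of_winsOrd P hP hwin'
  refine ⟨ν, fun b hb hPb => ?_⟩
  obtain ⟨Φ, w, hΦ0, hdet, hw1, hwpos, hcl⟩ := h3 b hb hPb
  exact ⟨Φ, w, ⟨hΦ0, hdet, hw1, hwpos⟩, hcl⟩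

end TameFourTupleDrop

end Summit.ResolutionOfSingularities.ResolutionOfSingularities.Theorems

end
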